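import Summits.CriticalPhenomena.PercolationContinuityZ3.Theses.PercAnnulusCrossing
import Summits.CriticalPhenomena.PercolationContinuityZ3.Theorems.PercNearOneGluingNoHeavyLowerTailCSHTheoremOne
import Summits.CriticalPhenomena.PercolationContinuityZ3.Theorems.PercAnnulusCrossingBoxCrossingLength
import Summits.CriticalPhenomena.PercolationContinuityZ3.Theorems.PercAnnulusCrossingSpanningCountBK
import HarnessLib

/-!
# `PercAnnulusCrossing.SurfaceRSW3D` (stmt-CriticalPhenomena-0869) — SETTLED after continuity

Item `stmt-CriticalPhenomena-0869` of route `CriticalPhenomena/PercAnnulusCrossing` (support (rank 3)): a monotone positive `f` with `f(P_p(cube (n;n,n) not crossed)) ≤ P_p(box (2n;n,n) not crossed lengthwise)` for all `p`, `n ≥ 1`.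

Witness `f = id`: a lengthwise crossing of the long block `[0,2n]×[0,n]²` contains, up to its first visit to the plane `{x₀ = n}`, a crossing of the cube `[0,n]³` — Kesten's Comment (v), the lane's `Crossing.real_boxCross_anti_length` — so the blocking probabilities compare the other way.  (The refuter's evidence `Proof0869.lean`, f = id, is reproduced with the lane's crossing vocabulary `Crossing.boxCross`.)  p205010 is NOT used.

builds on p205010 (kernel theorem, internal audit signed; external expert review pending) — USED (`CSH.percolationContinuityZ3_holds`).  RSW3 lane, lead gen 28 (prover-prim-rsw3-lead-g28-0):
'after continuity — the ledger harvest'.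
References: G. Kozma, N. Nitzan (2024), Thm. 6 / Conj. 3 [KozmaNitzan2024]; G. Grimmett, *Percolation* (1999), §8 [GrimmettPercolation1999].
-/

noncomputable section

namespace Summit.CriticalPhenomena.PercolationContinuityZ3.Theorems

namespace PercAnnulusCrossingSurfaceRSW3D

open MeasureTheory Literature.Probability.Percolation Literature.Probability.LatticeModels
open Summit.CriticalPhenomena.PercolationContinuityZ3.Theorems.Crossing

/-- **`PercAnnulusCrossing.SurfaceRSW3D` (stmt-CriticalPhenomena-0869), settled.**  witness `f = id`, by `Crossing.real_boxCross_anti_length` and complements.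
[cite: KozmaNitzan2024, Thm. 6 with Conj. 3 (p. 15)] -/
theorem surfaceRSW3D_proof : Summit.CriticalPhenomena.PercolationContinuityZ3.Theses.PercAnnulusCrossing.SurfaceRSW3D := by
  unfold Summit.CriticalPhenomena.PercolationContinuityZ3.Theses.PercAnnulusCrossing.SurfaceRSW3D
  refine ⟨id, monotone_id, fun s hs => hs, fun p n _ => ?_⟩
  have hA : ∀ m : ℤ, {ω : BondConfig (Site 3) | ¬ ∃ x ∈ Finset.Icc (0 : Site 3) ![m, n, n], ∃ y ∈ Finset.Icc (0 : Site 3) ![m, n, n],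
      x 0 = 0 ∧ y 0 = m ∧ ω ∈ openConnIn ↑(Finset.Icc (0 : Site 3) ![m, n, n]) x y} = (boxCross ![m, (n : ℤ), n] 0)ᶜ := by
    intro m; rfl
  have h1 := hA (n : ℤ)
  have h2 := hA (2 * (n : ℤ))
  simp only [id]
  rw [h1, h2, measureReal_compl (measurableSet_boxCross _ _), measureReal_compl (measurableSet_boxCross _ _)]
  have hmono := real_boxCross_anti_length p (L := ![(n : ℤ), n, n]) (L' := ![2 * (n : ℤ), n, n]) (i := 0)
    (by simp) (by simp; omega) (fun j hj => by fin_cases j <;> simp_all)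
  linarith

end PercAnnulusCrossingSurfaceRSW3D

end Summit.CriticalPhenomena.PercolationContinuityZ3.Theorems

end
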